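import Mathlib.AlgebraicGeometry.Modules.Sheaf
import Mathlib.Algebra.Category.ModuleCat.Sheaf.PushforwardContinuous
import Mathlib.Topology.Sheaves.SheafCondition.UniqueGluing
import HarnessLib

/-!
# The internal Hom `𝓗om_{𝒪_X}(E, M)` of `𝒪_X`-modules on a scheme

For a scheme `X` and `𝒪_X`-modules `E`, `M` (objects of Mathlib's abelian category `X.Modules` of
sheaves of modules over `X.ringCatSheaf`) we construct the **sheaf Hom**
`sheafHom E M : X.Modules`, the `𝒪_X`-module

  `U ↦ Hom_{𝒪_X|_U}(E|_U, M|_U)`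

(Hartshorne, *Algebraic Geometry*, II Ex. 1.15 "the presheaf `U ↦ Hom(𝓕|_U, 𝓖|_U)` is a sheaf …
sheaf hom", and II.5, p. 109: for `𝒪_X`-modules it "is a sheaf, which we call the sheaf `𝓗om` …
It is also an `𝒪_X`-module"; EGA 0_I (4.1.1); The Stacks project, Tag 01CM). Restrictions
`E|_U` are Mathlib's `SheafOfModules.over` (modules over `𝒪_X.over U` on the site `Over U` of opens
below `U`), the same carrier as the tree's local-freeness predicates
(`Literature.AlgebraicGeometry.Motives.IsFiniteLocallyFree`, `HasRank`).

## Contents (everything proved, no named facts)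

* `overScalar M U a : M|_U ⟶ M|_U` — multiplication by `a ∈ Γ(X, U)` (a morphism of modules since
  `𝒪_X` is commutative), a ring map `overScalarRingHom : Γ(X, U) →+* End(M|_U)`, whence the
  `Γ(X, U)`-module structure `moduleOverHom` on `Hom(E|_U, M|_U)` (`a • φ = φ ≫ overScalar a`).
* `restrictHom i φ : E|_V ⟶ M|_V` — restriction of `φ : E|_U ⟶ M|_U` along `i : V ⟶ U`
  (Mathlib's `SheafOfModules.overMap`, conjugated by `overFunctorMap`): functorial, additive,
  semilinear (`restrictHom_smul`), multiplicative (`restrictHom_comp`).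
* `appLE φ k s ∈ Γ(M, W)` — the value of `φ : E|_U ⟶ M|_U` on a section `s ∈ Γ(E, W)`, `k : W ⟶ U`,
  with its calculus (additive, `𝒪(W)`-linear, natural in `W`, `hom_ext_of_appLE`).
* `homPresheaf E M` — the presheaf of modules `U ↦ Hom(E|_U, M|_U)`; `glueHom`,
  `restrictHom_glueHom`, `eq_glueHom` — **morphisms glue uniquely along open covers** (the value of
  the glued morphism at `s ∈ Γ(E, W)` is glued in the sheaf `M` from the values of the pieces on
  `W ⊓ U_i`); `isSheaf_homPresheaf` (Mathlib's `TopCat.Presheaf.isSheaf_iff_isSheafUniqueGluing`);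
  `sheafHom E M : X.Modules`.

Functoriality in `M`, the unit `𝒪_X → 𝓔nd(E)`, evaluation and biduality maps are in
`Modules/SheafHomFunctor.lean`; exactness of `𝓗om(E, –)` for `E` finite locally free and the
trace `𝓔nd(E) → 𝒪_X` in further files of this series (built for the Atiyah class / trace maps of
`HodgeTheory/AtiyahClassTrace.lean`).

## Design notes

* Mathlib (this pin) has no internal Hom or tensor product of SHEAVES of modules (searched:
  `sheafHom`/`presheafHom` exist only for sheaves of types, `CategoryTheory.Sites.SheafHom`;
  `PresheafOfModules` has a monoidal structure but no closed structure; nothing under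
  `AlgebraicGeometry.Modules`). The internal Hom needs no sheafification, which is why this series
  models `E^∨ ⊗ M` as `𝓗om(E, M)` and `E ⊗ Ω¹` as `𝓗om(E^∨, Ω¹)` for `E` finite locally free
  (Hartshorne II Ex. 5.1 (b)).
* Sections over `U` are literally the Hom-type `E.over U ⟶ M.over U` of
  `SheafOfModules (X.ringCatSheaf.over U)`, so that trivialisations `free I ≅ E.over U` act on them
  by composition. All identifications `(E|_U)|_V = E|_V` hold definitionally on objects of `Over`,
  and the restriction calculus is by `rfl`.
* Names are plain (`sheafHom`, not dot-notation on `Scheme.Modules`) to stay inside the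
  `Literature.AlgebraicGeometry.Modules` namespace.

## References

* R. Hartshorne, *Algebraic Geometry*, GTM 52 (1977): II Ex. 1.15 (p. 67), II.5 (p. 109),
  II Ex. 5.1 (p. 123) (held copy, PDF pp. 89, 138, 156). [Hartshorne1977]
* The Stacks project, Tag 01CM (Modules: internal Hom). [StacksProject]
-/

noncomputable section

open CategoryTheory AlgebraicGeometry Opposite TopologicalSpace Limits

universe u

namespace Literature.AlgebraicGeometry.Modules

variable {X : Scheme.{u}}

/-! ### Multiplication by a section of `𝒪_X` on a restricted module -/

section OverScalar

variable (M : X.Modules) (U : X.Opens)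

/-- The restriction of `a ∈ Γ(X, U)` to an open `V` over `U`, as an element of the ring of
sections of the restricted structure sheaf `(𝒪_X)|_U` at `V`. [folklore] -/
def overRes (U : X.Opens) (V : (Over U)ᵒᵖ) (a : Γ(X, U)) : (X.ringCatSheaf.over U).obj.obj V :=
  (X.presheaf.map V.unop.hom.op a : Γ(X, V.unop.left))

/-- `overRes` is compatible with restriction. [folklore] -/
lemma overRes_map {V W : (Over U)ᵒᵖ} (f : V ⟶ W) (a : Γ(X, U)) :
    (X.ringCatSheaf.over U).obj.map f (overRes U V a) = overRes U W a := by
  change (X.presheaf.map V.unop.hom.op ≫ X.presheaf.map f.unop.left.op) a = _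
  rw [← X.presheaf.map_comp]
  rfl

/-- `overRes a` is central (the structure sheaf is commutative). [folklore] -/
lemma overRes_comm (V : (Over U)ᵒᵖ) (a : Γ(X, U)) (s : (X.ringCatSheaf.over U).obj.obj V) :
    overRes U V a * s = s * overRes U V a :=
  mul_comm (X.presheaf.map V.unop.hom.op a : Γ(X, V.unop.left)) s

/-- `overRes 1 = 1`. [folklore] -/
lemma overRes_one (V : (Over U)ᵒᵖ) : overRes U V (1 : Γ(X, U)) = 1 :=
  map_one (X.presheaf.map V.unop.hom.op).hom

/-- `overRes` is multiplicative. [folklore] -/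
lemma overRes_mul (V : (Over U)ᵒᵖ) (a b : Γ(X, U)) :
    overRes U V (a * b) = overRes U V a * overRes U V b :=
  map_mul (X.presheaf.map V.unop.hom.op).hom a b

/-- `overRes` is additive. [folklore] -/
lemma overRes_add (V : (Over U)ᵒᵖ) (a b : Γ(X, U)) :
    overRes U V (a + b) = overRes U V a + overRes U V b :=
  map_add (X.presheaf.map V.unop.hom.op).hom a b

/-- Multiplication by (the restrictions of) a section `a ∈ Γ(X, U)` of the structure sheaf: an
endomorphism of the restriction `M|_U = M.over U` of an `𝒪_X`-module `M` to the opens over `U`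
(it is `𝒪`-linear because `𝒪_X` is a sheaf of commutative rings). [folklore] -/
def overScalar (a : Γ(X, U)) : M.over U ⟶ M.over U where
  val := PresheafOfModules.homMk
    { app := fun V => AddCommGrpCat.ofHom
        (DistribSMul.toAddMonoidHom ((M.over U).val.obj V) (overRes U V a))
      naturality := fun {V W} f => by
        ext m
        change overRes U W a • (M.over U).val.map f m = (M.over U).val.map f (overRes U V a • m)
        exact ((congrArg (· • (M.over U).val.map f m) (overRes_map U f a)).symm.trans
          ((M.over U).val.map_smul f (overRes U V a) m).symm) }
    (fun V s m => by
      change overRes U V a • (s • m) = s • (overRes U V a • m)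
      rw [smul_smul, smul_smul, overRes_comm])

/-- Components of `overScalar`: multiplication by the restriction of `a`. [folklore] -/
lemma overScalar_app_apply (a : Γ(X, U)) (V : (Over U)ᵒᵖ) (m : (M.over U).val.obj V) :
    (overScalar M U a).val.app V m = overRes U V a • m := rfl

variable {M U}

/-- `overScalar` is the identity for `a = 1`. [folklore] -/
@[simp]
lemma overScalar_one : overScalar M U 1 = 𝟙 _ := by
  ext V m
  change overRes U V 1 • m = m
  rw [overRes_one, one_smul]

/-- `overScalar` is multiplicative. [folklore] -/
lemma overScalar_mul (a b : Γ(X, U)) :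
    overScalar M U (a * b) = overScalar M U b ≫ overScalar M U a := by
  ext V m
  change overRes U V (a * b) • m = overRes U V a • (overRes U V b • m)
  rw [overRes_mul, mul_smul]

/-- `overScalar` is additive. [folklore] -/
lemma overScalar_add (a b : Γ(X, U)) :
    overScalar M U (a + b) = overScalar M U a + overScalar M U b := by
  ext V m
  change overRes U V (a + b) • m = overRes U V a • m + overRes U V b • m
  rw [overRes_add, add_smul]

/-- Morphisms of `𝒪_X`-modules commute with multiplication by sections of `𝒪_X`. [folklore] -/
@[reassoc]
lemma over_map_overScalar {M N : X.Modules} (f : M ⟶ N) (U : X.Opens) (a : Γ(X, U)) :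
    (SheafOfModules.overFunctor _ U).map f ≫ overScalar N U a =
      overScalar M U a ≫ (SheafOfModules.overFunctor _ U).map f := by
  ext V m
  change overRes U V a • ((SheafOfModules.overFunctor _ U).map f).val.app V m =
    ((SheafOfModules.overFunctor _ U).map f).val.app V (overRes U V a • m)
  rw [map_smul]

variable (M U) in
/-- Multiplication by sections of `𝒪_X(U)` as a ring homomorphism `Γ(X, U) → End(M|_U)`
(`End` multiplies by composition in the reverse order). [folklore] -/
def overScalarRingHom : Γ(X, U) →+* End (M.over U) where
  toFun := overScalar M U
  map_one' := overScalar_one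
  map_mul' a b := by rw [End.mul_def]; exact overScalar_mul a b
  map_zero' := by
    have h := overScalar_add (M := M) (U := U) 0 0
    rw [add_zero] at h
    exact left_eq_add.mp h
  map_add' := overScalar_add

/-- **The `𝒪_X(U)`-module structure on `Hom_{𝒪_U}(E|_U, M|_U)`**: `(a • φ) = φ` followed by
multiplication by `a` on `M|_U`. These are the sections over `U` of the internal Hom
`𝓗om_{𝒪_X}(E, M)`. [folklore] -/
instance moduleOverHom (E M : X.Modules) (U : X.Opens) : Module Γ(X, U) (E.over U ⟶ M.over U) :=
  Module.compHom _ (overScalarRingHom M U)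

/-- Unfolding the module structure: `a • φ = φ ≫ overScalar a`. [folklore] -/
lemma smul_overHom_def {E M : X.Modules} {U : X.Opens} (a : Γ(X, U)) (φ : E.over U ⟶ M.over U) :
    a • φ = φ ≫ overScalar M U a := rfl

/-- Components of `a • φ`. [folklore] -/
lemma smul_overHom_app_apply {E M : X.Modules} {U : X.Opens} (a : Γ(X, U))
    (φ : E.over U ⟶ M.over U) (V : (Over U)ᵒᵖ) (s : (E.over U).val.obj V) :
    (a • φ).val.app V s = overRes U V a • φ.val.app V s := rfl

end OverScalar

/-! ### Restriction of morphisms `E|_U → M|_U` to smaller opens -/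

section Restrict

variable {E M N : X.Modules} {U V W : X.Opens}

/-- Restriction of a morphism `φ : E|_U → M|_U` along `i : V ⟶ U` to `φ|_V : E|_V → M|_V`
(Mathlib's `SheafOfModules.overMap` conjugated by the identifications `(E|_U)|_V = E|_V`,
`SheafOfModules.overFunctorMap`). [folklore] -/
def restrictHom (i : V ⟶ U) (φ : E.over U ⟶ M.over U) : E.over V ⟶ M.over V :=
  ((SheafOfModules.overFunctorMap X.ringCatSheaf i).app E).inv ≫
    (SheafOfModules.overMap X.ringCatSheaf i).map φ ≫
      ((SheafOfModules.overFunctorMap X.ringCatSheaf i).app M).hom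

/-- Components of a restricted morphism: `(φ|_V)_W = φ_W` for `W` over `V`. [folklore] -/
lemma restrictHom_app_apply (i : V ⟶ U) (φ : E.over U ⟶ M.over U) (W : (Over V)ᵒᵖ)
    (s : (E.over V).val.obj W) :
    (restrictHom i φ).val.app W s =
      (φ.val.app (op ((Over.map i).obj W.unop)) s :
        (M.over U).val.obj (op ((Over.map i).obj W.unop))) := by
  rfl

/-- Restriction along an identity does nothing. [folklore] -/
@[simp]
lemma restrictHom_id' (φ : E.over U ⟶ M.over U) : restrictHom (𝟙 U) φ = φ := by
  ext W s
  rfl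

/-- Restriction is transitive. [folklore] -/
lemma restrictHom_comp' (i : V ⟶ U) (j : W ⟶ V) (φ : E.over U ⟶ M.over U) :
    restrictHom (j ≫ i) φ = restrictHom j (restrictHom i φ) := by
  ext W s
  rfl

/-- Restriction is additive. [folklore] -/
lemma restrictHom_add (i : V ⟶ U) (φ ψ : E.over U ⟶ M.over U) :
    restrictHom i (φ + ψ) = restrictHom i φ + restrictHom i ψ := by
  ext W s
  rfl

/-- Restriction of the zero morphism. [folklore] -/
@[simp]
lemma restrictHom_zero (i : V ⟶ U) : restrictHom i (0 : E.over U ⟶ M.over U) = 0 := by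
  ext W s
  rfl

/-- Restriction is compatible with composition of morphisms. [folklore] -/
lemma restrictHom_comp (i : V ⟶ U) (φ : E.over U ⟶ M.over U) (ψ : M.over U ⟶ N.over U) :
    restrictHom i (φ ≫ ψ) = restrictHom i φ ≫ restrictHom i ψ := by
  ext W s
  rfl

/-- Restriction of an identity morphism is the identity. [folklore] -/
@[simp]
lemma restrictHom_id (i : V ⟶ U) : restrictHom i (𝟙 (E.over U)) = 𝟙 (E.over V) := by
  ext W s
  rfl

/-- Restriction of scalars commutes with restriction to opens: `(f|_U)|_V = f|_V` for a morphism
`f : E → M` of `𝒪_X`-modules. [folklore] -/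
@[simp]
lemma restrictHom_over_map (i : V ⟶ U) (f : E ⟶ M) :
    restrictHom i ((SheafOfModules.overFunctor _ U).map f) =
      (SheafOfModules.overFunctor _ V).map f := by
  ext W s
  rfl

end Restrict

/-! ### Values of a morphism `E|_U → M|_U` on sections over smaller opens -/

section AppLE

variable {E M N : X.Modules} {U V W : X.Opens}

/-- The value `φ_W(s) ∈ Γ(M, W)` of a morphism `φ : E|_U → M|_U` on a section `s ∈ Γ(E, W)` over
an open `W ≤ U` (given by `k : W ⟶ U`). [folklore] -/
def appLE (φ : E.over U ⟶ M.over U) (k : W ⟶ U) (s : Γ(E, W)) : Γ(M, W) :=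
  φ.val.app (op (Over.mk k)) s

/-- Unfolding `appLE`. [folklore] -/
lemma appLE_def (φ : E.over U ⟶ M.over U) (k : W ⟶ U) (s : Γ(E, W)) :
    appLE φ k s = φ.val.app (op (Over.mk k)) s := rfl

/-- `φ ↦ φ_W(s)` is additive in `φ`. [folklore] -/
lemma appLE_add (φ ψ : E.over U ⟶ M.over U) (k : W ⟶ U) (s : Γ(E, W)) :
    appLE (φ + ψ) k s = appLE φ k s + appLE ψ k s := rfl

/-- The zero morphism has zero values. [folklore] -/
@[simp]
lemma appLE_zero (k : W ⟶ U) (s : Γ(E, W)) : appLE (0 : E.over U ⟶ M.over U) k s = 0 := rfl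

/-- `s ↦ φ_W(s)` is additive. [folklore] -/
lemma appLE_add_right (φ : E.over U ⟶ M.over U) (k : W ⟶ U) (s t : Γ(E, W)) :
    appLE φ k (s + t) = appLE φ k s + appLE φ k t :=
  map_add (φ.val.app (op (Over.mk k))).hom s t

/-- `φ_W(0) = 0`. [folklore] -/
@[simp]
lemma appLE_zero_right (φ : E.over U ⟶ M.over U) (k : W ⟶ U) : appLE φ k (0 : Γ(E, W)) = 0 :=
  map_zero (φ.val.app (op (Over.mk k))).hom

/-- `s ↦ φ_W(s)` is `𝒪_X(W)`-linear. [folklore] -/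
lemma appLE_smul_right (φ : E.over U ⟶ M.over U) (k : W ⟶ U) (r : Γ(X, W)) (s : Γ(E, W)) :
    appLE φ k (r • s) = r • appLE φ k s :=
  (φ.val.app (op (Over.mk k))).hom.map_smul r s

/-- `(a • φ)_W(s) = a|_W • φ_W(s)`. [folklore] -/
lemma appLE_smul (a : Γ(X, U)) (φ : E.over U ⟶ M.over U) (k : W ⟶ U) (s : Γ(E, W)) :
    appLE (a • φ) k s = X.presheaf.map k.op a • appLE φ k s := rfl

/-- Naturality: `φ_{W'}(s|_{W'}) = φ_W(s)|_{W'}`. [folklore] -/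
lemma appLE_map (φ : E.over U ⟶ M.over U) (k : W ⟶ U) (l : V ⟶ W) (s : Γ(E, W)) :
    appLE φ (l ≫ k) (E.presheaf.map l.op s) = M.presheaf.map l.op (appLE φ k s) :=
  PresheafOfModules.naturality_apply φ.val (Over.homMk l : Over.mk (l ≫ k) ⟶ Over.mk k).op s

/-- Restricted morphisms have the same values: `(φ|_V)_W(s) = φ_W(s)`. [folklore] -/
@[simp]
lemma appLE_restrictHom (i : V ⟶ U) (φ : E.over U ⟶ M.over U) (k : W ⟶ V) (s : Γ(E, W)) :
    appLE (restrictHom i φ) k s = appLE φ (k ≫ i) s := rfl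

/-- Values of a composite. [folklore] -/
lemma appLE_comp (φ : E.over U ⟶ M.over U) (ψ : M.over U ⟶ N.over U) (k : W ⟶ U) (s : Γ(E, W)) :
    appLE (φ ≫ ψ) k s = appLE ψ k (appLE φ k s) := rfl

/-- The identity has values `s ↦ s`. [folklore] -/
@[simp]
lemma appLE_id (k : W ⟶ U) (s : Γ(E, W)) : appLE (𝟙 (E.over U)) k s = s := rfl

/-- Values of `f|_U` for a morphism of `𝒪_X`-modules `f`. [folklore] -/
@[simp]
lemma appLE_over_map (f : E ⟶ M) (k : W ⟶ U) (s : Γ(E, W)) :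
    appLE ((SheafOfModules.overFunctor _ U).map f) k s = f.app W s := rfl

/-- Values of `overScalar a`. [folklore] -/
@[simp]
lemma appLE_overScalar (a : Γ(X, U)) (k : W ⟶ U) (s : Γ(M, W)) :
    appLE (overScalar M U a) k s = X.presheaf.map k.op a • s := rfl

/-- Two morphisms `E|_U → M|_U` with the same values on all sections over all opens `W ≤ U` are
equal. [folklore] -/
lemma hom_ext_of_appLE {φ ψ : E.over U ⟶ M.over U}
    (h : ∀ ⦃W : X.Opens⦄ (k : W ⟶ U) (s : Γ(E, W)), appLE φ k s = appLE ψ k s) : φ = ψ := by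
  ext W s
  exact h W.unop.hom s

/-- Restriction is compatible with the `𝒪_X(U)`-module structures: `(a • φ)|_V = a|_V • φ|_V`.
[folklore] -/
lemma restrictHom_smul (i : V ⟶ U) (a : Γ(X, U)) (φ : E.over U ⟶ M.over U) :
    restrictHom i (a • φ) = X.presheaf.map i.op a • restrictHom i φ := by
  refine hom_ext_of_appLE fun W k s => ?_
  rw [appLE_restrictHom, appLE_smul, appLE_smul, appLE_restrictHom]
  congr 1
  change _ = (X.presheaf.map i.op ≫ X.presheaf.map k.op) a
  rw [← X.presheaf.map_comp]
  rfl

/-- `(overScalar a)|_V = overScalar (a|_V)`. [folklore] -/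
lemma restrictHom_overScalar (i : V ⟶ U) (a : Γ(X, U)) :
    restrictHom i (overScalar M U a) = overScalar M V (X.presheaf.map i.op a) := by
  have h := restrictHom_smul (E := M) i a (𝟙 (M.over U))
  rwa [smul_overHom_def, smul_overHom_def, Category.id_comp, restrictHom_id,
    Category.id_comp] at h

end AppLE

/-! ### The presheaf of modules `U ↦ Hom(E|_U, M|_U)` -/

section Presheaf

variable (E M : X.Modules)

/-- The presheaf of abelian groups `U ↦ Hom_{𝒪_U}(E|_U, M|_U)` with restriction `restrictHom`.
[folklore] -/
def homPresheafAb : TopCat.Presheaf Ab X where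
  obj U := AddCommGrpCat.of (E.over U.unop ⟶ M.over U.unop)
  map i := AddCommGrpCat.ofHom
    { toFun := restrictHom i.unop
      map_zero' := restrictHom_zero i.unop
      map_add' := restrictHom_add i.unop }
  map_id U := by
    refine AddCommGrpCat.ext fun φ => ?_
    exact restrictHom_id' φ
  map_comp i j := by
    refine AddCommGrpCat.ext fun φ => ?_
    exact restrictHom_comp' i.unop j.unop φ

/-- The restriction maps of `homPresheafAb` are `restrictHom`. [folklore] -/
@[simp]
lemma homPresheafAb_map_apply {U V : (X.Opens)ᵒᵖ} (i : U ⟶ V) (φ : E.over U.unop ⟶ M.over U.unop) :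
    (homPresheafAb E M).map i φ = restrictHom i.unop φ := rfl

/-- The presheaf of `𝒪_X`-modules `U ↦ Hom_{𝒪_U}(E|_U, M|_U)` (an `𝒪_X(U)`-module through
`moduleOverHom`, restriction maps semilinear by `restrictHom_smul`). [folklore] -/
def homPresheaf : X.PresheafOfModules :=
  @PresheafOfModules.ofPresheaf _ _ X.ringCatSheaf.obj (homPresheafAb E M)
    (fun U => moduleOverHom E M U.unop) (fun _ _ i a φ => restrictHom_smul i.unop a φ)

/-- The underlying abelian presheaf of `homPresheaf` is `homPresheafAb`. [folklore] -/
@[simp]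
lemma homPresheaf_presheaf : (homPresheaf E M).presheaf = homPresheafAb E M := rfl

end Presheaf

/-! ### The sheaf condition: morphisms glue -/

section Glue

variable {E M : X.Modules} {V : X.Opens} {ι : Type u} (U : ι → X.Opens)
  (sf : ∀ i, E.over (U i) ⟶ M.over (U i))

/-- Restricting twice is restricting once (sections of `E`). [folklore] -/
lemma presheaf_map_map (E : X.Modules) {W V Y : X.Opens} (l : V ⟶ W) (l' : Y ⟶ V) (s : Γ(E, W)) :
    E.presheaf.map l'.op (E.presheaf.map l.op s) = E.presheaf.map (l' ≫ l).op s := by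
  rw [op_comp, Functor.map_comp]
  rfl

/-- The value `φ_W(s)` does not depend on the name of the inclusion `W ≤ U`. [folklore] -/
lemma appLE_congr_hom (φ : E.over V ⟶ M.over V) {W : X.Opens} (k k' : W ⟶ V) (s : Γ(E, W)) :
    appLE φ k s = appLE φ k' s := by
  rw [Subsingleton.elim k k']

/-- The local pieces `(sf i)_{W ⊓ U_i}(s|_{W ⊓ U_i}) ∈ Γ(M, W ⊓ U_i)` of the value at
`s ∈ Γ(E, W)` of the morphism glued from the family `sf`. [folklore] -/
def gluePieces {W : X.Opens} (s : Γ(E, W)) (i : ι) : Γ(M, W ⊓ U i) :=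
  appLE (sf i) (Opens.infLERight W (U i)) (E.presheaf.map (Opens.infLELeft W (U i)).op s)

variable (hsf : ∀ i j, restrictHom (Opens.infLELeft (U i) (U j)) (sf i) =
  restrictHom (Opens.infLERight (U i) (U j)) (sf j))

include hsf in
/-- On an open `Y` below both `U_i` and `U_j`, the morphisms `sf i` and `sf j` have the same
values. [folklore] -/
lemma appLE_eq_of_compatible {Y : X.Opens} (i j : ι) (ki : Y ⟶ U i) (kj : Y ⟶ U j) (s : Γ(E, Y)) :
    appLE (sf i) ki s = appLE (sf j) kj s := by
  have hij : Y ≤ U i ⊓ U j := le_inf ki.le kj.le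
  rw [appLE_congr_hom (sf i) ki (homOfLE hij ≫ Opens.infLELeft (U i) (U j)),
    appLE_congr_hom (sf j) kj (homOfLE hij ≫ Opens.infLERight (U i) (U j)),
    ← appLE_restrictHom, ← appLE_restrictHom, hsf i j]

include hsf in
/-- The local pieces are compatible on overlaps. [folklore] -/
lemma gluePieces_compatible {W : X.Opens} (s : Γ(E, W)) (i j : ι) :
    M.presheaf.map (Opens.infLELeft (W ⊓ U i) (W ⊓ U j)).op (gluePieces U sf s i) =
      M.presheaf.map (Opens.infLERight (W ⊓ U i) (W ⊓ U j)).op (gluePieces U sf s j) := by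
  simp only [gluePieces, ← appLE_map, presheaf_map_map]
  rw [Subsingleton.elim (Opens.infLELeft (W ⊓ U i) (W ⊓ U j) ≫ Opens.infLELeft W (U i))
    (Opens.infLERight (W ⊓ U i) (W ⊓ U j) ≫ Opens.infLELeft W (U j))]
  exact appLE_eq_of_compatible U sf hsf i j _ _ _

variable {U} in
/-- An open below `⨆ U_i` is covered by its intersections with the `U_i`. [folklore] -/
lemma le_iSup_inf {W : X.Opens} (k : W ⟶ iSup U) : W ≤ ⨆ i, W ⊓ U i := by
  rw [← inf_iSup_eq]
  exact le_inf le_rfl k.le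

include hsf in
/-- **Existence and uniqueness of the glued value** at `s ∈ Γ(E, W)`, `W ≤ ⨆ U_i`: the unique
section of `M` over `W` restricting to the local pieces (sheaf property of `M`). [folklore] -/
theorem existsUnique_glueValue {W : X.Opens} (k : W ⟶ iSup U) (s : Γ(E, W)) :
    ∃! t : Γ(M, W), ∀ i, M.presheaf.map (Opens.infLELeft W (U i)).op t = gluePieces U sf s i :=
  TopCat.Sheaf.existsUnique_gluing' ((SheafOfModules.toSheaf _).obj M) (fun i => W ⊓ U i) W
    (fun i => Opens.infLELeft W (U i)) (le_iSup_inf k) (gluePieces U sf s)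
    (fun i j => gluePieces_compatible U sf hsf s i j)

/-- The glued value at `s ∈ Γ(E, W)` (`W ≤ ⨆ U_i`). [folklore] -/
def glueValue {W : X.Opens} (k : W ⟶ iSup U) (s : Γ(E, W)) : Γ(M, W) :=
  (existsUnique_glueValue U sf hsf k s).choose

/-- The glued value restricts to the local pieces. [folklore] -/
lemma map_glueValue {W : X.Opens} (k : W ⟶ iSup U) (s : Γ(E, W)) (i : ι) :
    M.presheaf.map (Opens.infLELeft W (U i)).op (glueValue U sf hsf k s) = gluePieces U sf s i :=
  (existsUnique_glueValue U sf hsf k s).choose_spec.1 i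

/-- Uniqueness of the glued value. [folklore] -/
lemma glueValue_unique {W : X.Opens} (k : W ⟶ iSup U) (s : Γ(E, W)) {t : Γ(M, W)}
    (ht : ∀ i, M.presheaf.map (Opens.infLELeft W (U i)).op t = gluePieces U sf s i) :
    t = glueValue U sf hsf k s :=
  (existsUnique_glueValue U sf hsf k s).choose_spec.2 t ht

/-- The glued value is additive in `s`. [folklore] -/
lemma glueValue_add {W : X.Opens} (k : W ⟶ iSup U) (s s' : Γ(E, W)) :
    glueValue U sf hsf k (s + s') = glueValue U sf hsf k s + glueValue U sf hsf k s' := by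
  symm
  refine glueValue_unique U sf hsf k _ fun i => ?_
  rw [map_add, map_glueValue, map_glueValue, gluePieces, gluePieces, gluePieces, map_add,
    appLE_add_right]

/-- The glued value is `𝒪_X(W)`-linear in `s`. [folklore] -/
lemma glueValue_smul {W : X.Opens} (k : W ⟶ iSup U) (r : Γ(X, W)) (s : Γ(E, W)) :
    glueValue U sf hsf k (r • s) = r • glueValue U sf hsf k s := by
  symm
  refine glueValue_unique U sf hsf k _ fun i => ?_
  rw [Scheme.Modules.map_smul, map_glueValue, gluePieces, gluePieces, Scheme.Modules.map_smul,
    appLE_smul_right]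

/-- The glued value is compatible with restriction. [folklore] -/
lemma map_glueValue_eq {W V : X.Opens} (k : W ⟶ iSup U) (l : V ⟶ W) (s : Γ(E, W)) :
    M.presheaf.map l.op (glueValue U sf hsf k s) =
      glueValue U sf hsf (l ≫ k) (E.presheaf.map l.op s) := by
  refine glueValue_unique U sf hsf (l ≫ k) _ fun i => ?_
  have hl : V ⊓ U i ≤ W ⊓ U i := inf_le_inf_right (U i) l.le
  rw [presheaf_map_map, Subsingleton.elim (Opens.infLELeft V (U i) ≫ l) (homOfLE hl ≫ Opens.infLELeft W (U i)),
    ← presheaf_map_map, map_glueValue, gluePieces, gluePieces, ← appLE_map, presheaf_map_map,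
    presheaf_map_map]
  rw [Subsingleton.elim (homOfLE hl ≫ Opens.infLELeft W (U i)) (Opens.infLELeft V (U i) ≫ l)]
  exact appLE_congr_hom _ _ _ _

include hsf in
/-- Over an open contained in some `U_{i₀}`, the glued value is the value of `sf i₀`. [folklore] -/
lemma glueValue_eq_appLE {W : X.Opens} (i₀ : ι) (k₀ : W ⟶ U i₀) (k : W ⟶ iSup U) (s : Γ(E, W)) :
    glueValue U sf hsf k s = appLE (sf i₀) k₀ s := by
  symm
  refine glueValue_unique U sf hsf k _ fun i => ?_
  rw [← appLE_map, gluePieces]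
  exact appLE_eq_of_compatible U sf hsf i₀ i _ _ _

include hsf in
/-- The values of any gluing of the family `sf` are the glued values. [folklore] -/
lemma appLE_eq_glueValue (ψ : E.over (iSup U) ⟶ M.over (iSup U))
    (hψ : ∀ i, restrictHom (Opens.leSupr U i) ψ = sf i) {W : X.Opens} (k : W ⟶ iSup U)
    (s : Γ(E, W)) : appLE ψ k s = glueValue U sf hsf k s := by
  refine glueValue_unique U sf hsf k _ fun i => ?_
  rw [← appLE_map, gluePieces, ← hψ i, appLE_restrictHom]
  exact appLE_congr_hom _ _ _ _

/-- **The glued morphism** `E|_{⨆ U_i} → M|_{⨆ U_i}` of a compatible family of morphisms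
`sf i : E|_{U_i} → M|_{U_i}`. [folklore] -/
def glueHom : E.over (iSup U) ⟶ M.over (iSup U) where
  val := PresheafOfModules.homMk
    { app := fun W => AddCommGrpCat.ofHom
        { toFun := fun s => glueValue U sf hsf W.unop.hom s
          map_zero' := by
            have h := glueValue_add U sf hsf W.unop.hom (0 : Γ(E, W.unop.left)) 0
            rw [add_zero] at h
            exact (left_eq_add.mp h).symm ▸ rfl
          map_add' := fun s s' => glueValue_add U sf hsf W.unop.hom s s' }
      naturality := fun {W V} g => by
        ext s
        change glueValue U sf hsf V.unop.hom ((E.over (iSup U)).val.map g s) =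
          (M.over (iSup U)).val.map g (glueValue U sf hsf W.unop.hom s)
        change glueValue U sf hsf V.unop.hom (E.presheaf.map g.unop.left.op s) =
          M.presheaf.map g.unop.left.op (glueValue U sf hsf W.unop.hom s)
        rw [map_glueValue_eq U sf hsf W.unop.hom g.unop.left s]
        rfl }
    (fun W r s => glueValue_smul U sf hsf W.unop.hom r s)

/-- The values of the glued morphism are the glued values. [folklore] -/
@[simp]
lemma appLE_glueHom {W : X.Opens} (k : W ⟶ iSup U) (s : Γ(E, W)) :
    appLE (glueHom U sf hsf) k s = glueValue U sf hsf k s := rfl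

/-- The glued morphism restricts to the given ones. [folklore] -/
theorem restrictHom_glueHom (i : ι) : restrictHom (Opens.leSupr U i) (glueHom U sf hsf) = sf i :=
  hom_ext_of_appLE fun _ k s => by
    rw [appLE_restrictHom, appLE_glueHom]
    exact glueValue_eq_appLE U sf hsf i k _ s

/-- The glued morphism is the only gluing. [folklore] -/
theorem eq_glueHom (ψ : E.over (iSup U) ⟶ M.over (iSup U))
    (hψ : ∀ i, restrictHom (Opens.leSupr U i) ψ = sf i) : ψ = glueHom U sf hsf :=
  hom_ext_of_appLE fun _ k s => by
    rw [appLE_glueHom]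
    exact appLE_eq_glueValue U sf hsf ψ hψ k s

end Glue

/-! ### The internal Hom as an `𝒪_X`-module -/

section SheafHom

variable (E M : X.Modules)

/-- **The presheaf `U ↦ Hom(E|_U, M|_U)` is a sheaf**: morphisms of sheaves of modules glue
uniquely along open covers. [folklore] -/
theorem isSheaf_homPresheaf : TopCat.Presheaf.IsSheaf (homPresheaf E M).presheaf :=
  (TopCat.Presheaf.isSheaf_iff_isSheafUniqueGluing _).2 fun _ U sf hsf => by
    have hsf' : ∀ i j, restrictHom (Opens.infLELeft (U i) (U j)) (sf i) =
        restrictHom (Opens.infLERight (U i) (U j)) (sf j) := fun i j => hsf i j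
    exact ⟨glueHom U _ hsf', restrictHom_glueHom U _ hsf', fun ψ hψ => eq_glueHom U _ hsf' ψ hψ⟩

/-- **The internal Hom (sheaf Hom) `𝓗om_{𝒪_X}(E, M)`** of two `𝒪_X`-modules on a scheme `X`: the
`𝒪_X`-module `U ↦ Hom_{𝒪_X|_U}(E|_U, M|_U)` (Hartshorne II.5, before Prop. 5.1; EGA 0_I 4.1.1; The
Stacks project, Tag 01CM). [cite: Hartshorne1977, II.5 (sheaf Hom, p. 109)] -/
def sheafHom : X.Modules where
  val := homPresheaf E M
  isSheaf := isSheaf_homPresheaf E M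

end SheafHom

end Literature.AlgebraicGeometry.Modules

end
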